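import Literature.MathematicalPhysics.QuantumFieldTheory.Balaban1983to89.B15Prop1EndpointFromLetterFamilies
import Summits.QuantumFields.YangMills.Theorems.BalabanUVNodesN12NearFlatChartLetterEta

/-!
# BalabanUVNodes ∕ N12 — PROPOSITION 1 [IV] AT PRINT'S (1.74) OBJECT ON THE COERCIVE ROAD, η-UNITS EDITION: from the R-explicit (J0′) letter, the GAUGE-LETTER family (σ)
# and the η-UNIT CHART CONSTANTS of dag-n12-w4's `chartLetter_of_letters_eta`, plus numerics ∕ geometry ∕ the [15] Theorem-1 letter

Cell `pub-ymgap` (HUMAN RULINGS D-0062 ∕ D-0149 ∕ D-0154), WIDTH SEAT `pub-ymgap-dag-n12-w5` g5 (node N12 = [B15]; key K1⁹ `stmt-QuantumFields-27364`, `--kind proof --supports …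
--as helper`; count-neutral).  Self-located R455 (A) claim in this seat's own stem (pub-ymgap INBOX 2026-08-28T12:19:05Z CLAIM-1∕INTENT-1): the η-road of the N12∕s1 lane
((iii) dag-n10-w1's `…N12NearFlatDelta2LetterEta` ∕ `…N12EtaSizeDefs.qEta`, dag-n12-w4 g4's (χ)_η `…N12NearFlatChartLetter.chartLetter_of_letters_eta` (p632050), this seat's
`B15Prop1NearFlatPackageFromLetters.hNFn_of_letters_eta_on` (p629636 §4)) had no ENDPOINT by name; this file and `B15Prop1EndpointFromLetterFamilies` §2 (v1.1, the letter form) are it.  THEOREMS ONLY (0 `def`, 0 `instance`, 0 `sorry`);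
composition BY NAME of this seat's `B15Prop1EndpointFromLetterFamilies.…_ofGaugeChartLettersEta_ofCoercive` (§2 v1.1 there: `B15Prop1CoerciveEdition.…_ofMinimiserFamily_ofCoercive` ∘ dag-n12-c g18's
`hcoer_of_nearFlatLettersNormalised_sub_loc` ∘ `hNFn_of_letters_eta_on`) and dag-n12-w4 g4's `chartLetter_of_letters_eta` (p632050) — the η-twin of p631882 (`…N12Prop1OfGaugeLetterAndChartConstants`).

WHY.  dag-n12-c g18's LANE WORD LOCATED-RHO exit (b) (pub-ymgap INBOX 2026-08-28T10:27:29Z) fixes the chart letter's size on the constraint space to print's level-weighted norm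
`q_η(v) = (Σ_l ((L^d)∕(L²))^{j_l}·‖v l‖²)^{1∕2}` ([Balaban1989LargeFieldII] (17)–(19) pp. 360–361): the currency in which the right-inverse letter `p (R_f v) ≤ ρc·q_η(v)` can be
volume- and `L`-uniform ([Balaban1985Variational] (44)–(46) p. 285; dag-n10-w1 g5's one-level exact Gram floor is the first `L`-uniform rung).  The consumers of an η-unit `ρc` are the
endpoint's numerics `hsm`; so the η-road needs the endpoint stated in η-units.  The Literature letter form (`B15Prop1EndpointFromLetterFamilies` §2) is p628231 with (χ) ↦ (χ)_η (the `hχ` premise of `hNFn_of_letters_eta_on` VERBATIM at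
the box region `𝒞 i := boxBonds (LO i) (HI i)`); §2 here is p631882 §2 with `hchart` ↦ the body of `chartLetter_of_letters_eta` (constants `ρs Cμ Cρ C₂ Cτ` as binders — (χ)_η's `C₂` already
carries the row-weight factor `√(Σ_l levelWeight j_l)` — `γ₀ := 1` by `T4Family.P_d`), §1 supplies `hchartη` instance by instance.  Everything else — (J0′) R-explicit `hMin`, the
GAUGE LETTER (σ) `hσ`, the smallness `0 < max (δc i) (δin i) ≤ ρs i`, the numerics `hsm`∕`hγle`∕`hcJ'` (TEXT identical to p631882's, so dag-n12-c g19's `B15Prop1NumericsThresholds`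
applies verbatim), the geometry (`hfar`, region boxes, `hΩw`, `hZblk`, box data) and the [15] Theorem-1 letter `h15T` — is displayed binder for binder as in p628231 ∕ p631882.

CONTENTS.  §1 ★ `hchart_of_chartLetter_eta`; §2 ★★★ `…_ofMinimiserFamily_ofGaugeLetter_ofChartConstantsEta_ofCoercive` (chart side by name).

HONEST FRAMING ∕ LOCATED.  Composition by name + one `γ₀ = 1` rewrite; a CURRENCY edition: `ρc` in η-units is still dag-n10-w1's letter of the flat right inverse with the
LOCATED-RHO floor (no `O(1)` η-unit upper letter is claimed here; the multi-level Gram floor of [Balaban1985Variational] (46) stays open); (J0′), (σ), [15] Thm 1, the numerics and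
the geometry stay LETTERS; nothing of Bałaban's is asserted; N12 NOT discharged; K1⁹ NOT closed; counts unmoved; one finite 𝕋⁴ programme at fixed `ε = L^{-K}` — R4 closes only
the conditional rung `BalabanLadder.UV`; no summit statement is proved here and NOT the Yang–Mills mass gap (Clay); nothing continuum ∕ ℝ⁴ ∕ OS.

References: [Balaban1989LargeFieldI] CMP 122 (1989) 175–202, (1.74) p.192, Prop. 1 (1.77)–(1.78) p.194, (1.79) p.195; [Balaban1989LargeFieldII] CMP 122 (1989) 355–392, p.357,
(1.7)–(1.9) p.358, (1.12)–(1.13) p.359, (17)–(19) pp.360–361; [Balaban1985Variational] CMP 102 (1985) 277–309, (3)–(4) p.278, Thm 1 (8) p.279, (16)–(18) p.280, (44)–(48) p.285,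
(81)–(83) p.290, (172) p.305, Prop. 9 (190) p.309; [Balaban1988Convergent] CMP 119 (1988) 243–285, (2.2) p.255, (2.10)–(2.14) pp.256–257.
-/

noncomputable section

open Set Finset Metric Filter
open scoped BigOperators Matrix RealInnerProductSpace Real InnerProductSpace Topology Matrix.Norms.L2Operator

namespace Summit.QuantumFields.YangMills.BalabanUVNodes.N12Prop1OfGaugeLetterAndChartConstantsEta

open Literature.MathematicalPhysics.QuantumFieldTheory.Balaban1983to89
open T4Continuum B15DeterminingSets GaugeField B16Sect1Backgrounds B15Prop1Carrier B8Eq17ClassAkV1 BlockAveraging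
open B15Prop1SliceTaylorCalculus
open B15Prop1ChartCalculusSU2 (E3)
open T4CubeChartGnomonic (SU2)
open B15Prop1ChartSU2 (su2Chart)
open B15Prop1SliceCoordinates (GaugeSlice ιA freeBonds)
open B15Prop1AnalyticExtClause (cplxVec anExt)
open T4AdjointCovarianceUnitary (lieSU)
open T4AxialGaugeSmallField (castSite boxPlaqs boxBonds)
open B6BondElimination (unitVec)
open B6TreeGaugePoincare (curl)
open B16Eq18Proof (box mem_box)
open B15Extension193 (extend)
open B15ShellGauge193 (shellGauge)
open B14.Eq213MaximalDomains (side)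
open B14.Eq213DetSet B14.Eq216Concrete B15Sect1Instances B15Eq177GaugeInvariance B15Eq177ValueInvariance B15Eq177ValueInvarianceCoDiv B16Sect1Wilson
open B14.Eq22Determines (blockIter IsBlockUnion)
open Literature.MathematicalPhysics.QuantumFieldTheory.BalabanImbrieJaffe1984to88.BIJ85Eq453GaugeField
open Node00 (expChart msChart constrCard)
open Summit.QuantumFields.YangMills.BalabanUVNodes.N12NearFlatChartLetter (chartLetter_of_letters_eta)

variable {F : T4Family}

/-! ## §1  The η-unit chart family from dag-n12-w4's `chartLetter_of_letters_eta`, instance by instance -/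

/-- ★ **THE CHART FAMILY IN η-UNITS FROM dag-n12-w4's `chartLetter_of_letters_eta`, INSTANCE BY INSTANCE** (the junction test and the knit's supplier of `hchartη`): for every
instance the multi-scale fibre chart letter package (χ)_η — size on the constraint space `q := q_η` spelled as print's level-weighted `ℓ²` lambda, `∃` over `Ψ₂ λ p L_f R_f` — with
its five constants; `choose ρs Cμ Cρ C₂ Cτ … using hchart_of_chartLetter_eta …` inside a proof, then §2.  `2 ≤ d` is `T4Family.P_d`; the chart file's box margin `hbox` follows
from the endpoint's `hN5`.  The η-twin of `N12Prop1OfGaugeLetterAndChartConstants.hchart_of_chartLetter`.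
[cite: Balaban1989LargeFieldII, p.357, (1.12)–(1.13) p.359, (17)–(19) pp.360–361; Balaban1985Variational, (44)–(48) p.285, (81)–(83) p.290, (172) p.305; Balaban1988Convergent, (2.10)–(2.13) pp.256–257] -/
theorem hchart_of_chartLetter_eta (ν : Node00.Stage7Numerics) (Kt : ℕ) (h0 : 0 < (F.P Kt).d) {ι : Type}
    (Z Λ : ι → Set (Site (F.P Kt) 0)) (k : ι → ℕ) (hk0 : ∀ i, 0 < k i) (hk : ∀ i, k i ≤ (F.P Kt).m + (F.P Kt).K)
    (T : ∀ i, Finset (PBond (F.P Kt) (k i))) (lo hi : ι → Fin (F.P Kt).d → ℤ)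
    (hN5 : ∀ i κ, ((hi i κ - lo i κ + 1).toNat : ℤ) + 5 < (F.P Kt).sitesPerDir (k i))
    (hM2 : 2 ≤ ν.M₁) (hdiv : ∀ i, side (F.P Kt).L ν.M₁ (k i) ∣ (F.P Kt).sitesPerDir 0)
    (hΩw : ∀ i, ∀ (ν' : Fin (F.P Kt).d), ∀ z ∈ box (fun κ => (hi i κ - lo i κ + 1).toNat + 3) (fun κ => lo i κ - 2),
      (castSite z : Site (F.P Kt) (k i)) ∈ pts (k i) (maxDomT ν.M₁ (Z i) (k i)) ∧
        (castSite z : Site (F.P Kt) (k i)).shift ⟨0, h0⟩ ∈ pts (k i) (maxDomT ν.M₁ (Z i) (k i)) ∧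
        (castSite z : Site (F.P Kt) (k i)).shift ν' ∈ pts (k i) (maxDomT ν.M₁ (Z i) (k i))) :
    ∀ i, ∃ ρs Cμ Cρ C₂ Cτ : ℝ, 0 < ρs ∧ 0 ≤ Cμ ∧ 0 ≤ Cρ ∧ 0 ≤ C₂ ∧ 0 ≤ Cτ ∧
      ∀ (ext' : GaugeField (F.P Kt) (k i) SU2 → GaugeField (F.P Kt) (k i) SU2) (Vk : GaugeField (F.P Kt) (k i) SU2) {R' A' : ℝ}, 0 < R' → 0 ≤ A' →
      ∀ {δ' δi' : ℝ}, 0 ≤ δ' → 0 ≤ δi' → 0 < max δ' δi' → max δ' δi' ≤ ρs →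
      ∀ (U₀ : GaugeField (F.P Kt) 0 SU2) (Xf : GaugeSlice (pts (k i) (Λ i)) (T i) E3 → PBond (F.P Kt) 0 → lieSU (Fin 2)),
      IsMinimizer (Node00.avOfRecord F 2 Kt) (Node00.regMSCoPOfRecord F 2 ν Kt (k i) (maxDomT ν.M₁ (Z i))) (Bj ν.M₁ (Z i) (k i))
        (avgFamily (Node00.avOfRecord F 2 Kt) (qsstarGIter0 (k i) (ext' Vk))) U₀ →
      (∀ p : Plaq (F.P Kt) 0, ((⟨p.src, p.μ⟩ : PBond (F.P Kt) 0) ∈ {b : PBond (F.P Kt) 0 | b.src ∈ maxDomT ν.M₁ (Z i) 1} ∨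
          (⟨p.src.shift p.μ, p.ν⟩ : PBond (F.P Kt) 0) ∈ {b : PBond (F.P Kt) 0 | b.src ∈ maxDomT ν.M₁ (Z i) 1} ∨
          (⟨p.src.shift p.ν, p.μ⟩ : PBond (F.P Kt) 0) ∈ {b : PBond (F.P Kt) 0 | b.src ∈ maxDomT ν.M₁ (Z i) 1} ∨
          (⟨p.src, p.ν⟩ : PBond (F.P Kt) 0) ∈ {b : PBond (F.P Kt) 0 | b.src ∈ maxDomT ν.M₁ (Z i) 1}) →
        ‖((U₀ ⟨p.src, p.μ⟩ : SU2) : Matrix (Fin 2) (Fin 2) ℂ) - 1‖ ≤ δ' ∧ ‖((U₀ ⟨p.src.shift p.μ, p.ν⟩ : SU2) : Matrix (Fin 2) (Fin 2) ℂ) - 1‖ ≤ δ' ∧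
          ‖((U₀ ⟨p.src.shift p.ν, p.μ⟩ : SU2) : Matrix (Fin 2) (Fin 2) ℂ) - 1‖ ≤ δ' ∧ ‖((U₀ ⟨p.src, p.ν⟩ : SU2) : Matrix (Fin 2) (Fin 2) ℂ) - 1‖ ≤ δ') →
      (∀ b ∈ inputs (Bj ν.M₁ (Z i) (k i)), ‖((U₀ b : SU2) : Matrix (Fin 2) (Fin 2) ℂ) - 1‖ ≤ δi') →
      Xf 0 = 0 → ContDiffAt ℝ 2 Xf 0 →
      (∀ᶠ Y in 𝓝 (0 : GaugeSlice (pts (k i) (Λ i)) (T i) E3),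
        IsMinimizer (Node00.avOfRecord F 2 Kt) (Node00.regMSCoPOfRecord F 2 ν Kt (k i) (maxDomT ν.M₁ (Z i))) (Bj ν.M₁ (Z i) (k i))
          (avgFamily (Node00.avOfRecord F 2 Kt) (qsstarGIter0 (k i) (expMul su2Chart (ιA (pts (k i) (Λ i)) (T i) Y) (ext' Vk)))) (expChart U₀ (Xf Y))) →
      (∀ (X : GaugeSlice (pts (k i) (Λ i)) (T i) E3) (b : PBond (F.P Kt) 0),
        ‖((fderiv ℝ Xf 0 X b : lieSU (Fin 2)) : Matrix (Fin 2) (Fin 2) ℂ)‖ ≤ 8 * A' / R' * ‖X‖ ∧ ‖fderiv ℝ Xf 0 X b‖ ≤ 12 * A' / R' * ‖X‖) →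
      (∀ (X : GaugeSlice (pts (k i) (Λ i)) (T i) E3) (b : PBond (F.P Kt) 0), b.src ∉ maxDomT ν.M₁ (Z i) 1 → fderiv ℝ Xf 0 X b = 0) →
      ∃ (Ψ₂ : (PBond (F.P Kt) 0 → lieSU (Fin 2)) →L[ℝ] (PBond (F.P Kt) 0 → lieSU (Fin 2)) →L[ℝ] (Fin (constrCard (Bj ν.M₁ (Z i) (k i)) (k i)) → lieSU (Fin 2)))
        (lam : (Fin (constrCard (Bj ν.M₁ (Z i) (k i)) (k i)) → lieSU (Fin 2)) →L[ℝ] ℝ)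
        (p : Seminorm ℝ (PBond (F.P Kt) 0 → lieSU (Fin 2)))
        (Lf : (PBond (F.P Kt) 0 → lieSU (Fin 2)) →L[ℝ] (Fin (constrCard (Bj ν.M₁ (Z i) (k i)) (k i)) → lieSU (Fin 2)))
        (Rf : (Fin (constrCard (Bj ν.M₁ (Z i) (k i)) (k i)) → lieSU (Fin 2)) → PBond (F.P Kt) 0 → lieSU (Fin 2)),
        HasFDerivAt (fun Y => fderiv ℝ (msChart F 2 Kt (k i) (Bj ν.M₁ (Z i) (k i)) (avgFamily (Node00.avOfRecord F 2 Kt) (qsstarGIter0 (k i) (ext' Vk))) U₀) Y) Ψ₂ 0 ∧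
        (∀ᶠ Y in 𝓝 (0 : PBond (F.P Kt) 0 → lieSU (Fin 2)),
          DifferentiableAt ℝ (msChart F 2 Kt (k i) (Bj ν.M₁ (Z i) (k i)) (avgFamily (Node00.avOfRecord F 2 Kt) (qsstarGIter0 (k i) (ext' Vk))) U₀) Y) ∧
        fderiv ℝ (fun Y : PBond (F.P Kt) 0 → lieSU (Fin 2) => wilsonAction4 (expChart U₀ Y)) 0 =
          lam.comp (fderiv ℝ (msChart F 2 Kt (k i) (Bj ν.M₁ (Z i) (k i)) (avgFamily (Node00.avOfRecord F 2 Kt) (qsstarGIter0 (k i) (ext' Vk))) U₀) 0) ∧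
        (∀ Y : PBond (F.P Kt) 0 → lieSU (Fin 2), ∑ b, ‖(Y b : Matrix (Fin 2) (Fin 2) ℂ)‖ ^ 2 ≤ p Y ^ 2) ∧
        (∀ v, Lf (Rf v) = v) ∧ (∀ v, p (Rf v) ≤ Cρ * Real.sqrt (∑ l, ((((F.P Kt).L : ℝ) ^ (F.P Kt).d) / (((F.P Kt).L : ℝ) ^ 2)) ^ (((Node00.constrEnum (Bj ν.M₁ (Z i) (k i) : DetSet (F.P Kt)) (k i)).symm l).1 : ℕ) * ‖(v) l‖ ^ 2)) ∧
        ∀ X : GaugeSlice (pts (k i) (Λ i)) (T i) E3,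
          Real.sqrt (∑ l, ((((F.P Kt).L : ℝ) ^ (F.P Kt).d) / (((F.P Kt).L : ℝ) ^ 2)) ^ (((Node00.constrEnum (Bj ν.M₁ (Z i) (k i) : DetSet (F.P Kt)) (k i)).symm l).1 : ℕ) * ‖(fderiv ℝ (msChart F 2 Kt (k i) (Bj ν.M₁ (Z i) (k i)) (avgFamily (Node00.avOfRecord F 2 Kt) (qsstarGIter0 (k i) (ext' Vk))) U₀) 0 (fderiv ℝ Xf 0 X) - Lf (fderiv ℝ Xf 0 X)) l‖ ^ 2)
            ≤ (C₂ * max δ' δi') * p (fderiv ℝ Xf 0 X) ∧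
          lam (Ψ₂ (fderiv ℝ Xf 0 X) (fderiv ℝ Xf 0 X)) ≤ (Cμ * max δ' δi') * p (fderiv ℝ Xf 0 X) ^ 2 ∧
          p (fderiv ℝ Xf 0 X) ≤ (12 * A' / R' * Real.sqrt (Nat.card {b : PBond (F.P Kt) 0 // b.src ∈ maxDomT ν.M₁ (Z i) 1})) * ‖X‖ ∧
          ∃ m : ℝ, (∀ w', Lf w' = fderiv ℝ (msChart F 2 Kt (k i) (Bj ν.M₁ (Z i) (k i)) (avgFamily (Node00.avOfRecord F 2 Kt) (qsstarGIter0 (k i) (ext' Vk))) U₀) 0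
                (fderiv ℝ Xf 0 X) →
              m ≤ fderiv ℝ (fun Y => fderiv ℝ (fun Y : PBond (F.P Kt) 0 → lieSU (Fin 2) => wilsonAction4 (expChart (1 : GaugeField (F.P Kt) 0 SU2) Y)) Y) 0 w' w') ∧
            (((F.P Kt).L : ℝ) ^ (F.P Kt).d) ^ (k i) / ((((F.P Kt).L : ℝ)) ^ 2 * ((F.P Kt).L : ℝ) ^ 2) ^ (k i) *
                (∑ z ∈ box (fun κ => (hi i κ - lo i κ + 1).toNat + 3) (fun κ => lo i κ - 2), ∑ μ : Fin (F.P Kt).d, ∑ a : Fin 3,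
                  curl (fun b => ιA (pts (k i) (Λ i)) (T i) X (⟨castSite b.1, b.2⟩ : PBond (F.P Kt) (k i)) a) z ⟨0, h0⟩ μ ^ 2)
              - ((((F.P Kt).L : ℝ) ^ (F.P Kt).d) ^ (k i) / ((((F.P Kt).L : ℝ)) ^ 2 * ((F.P Kt).L : ℝ) ^ 2) ^ (k i)
                  * (16 * (((F.P Kt).d : ℝ) + 1) * (Cτ * max δ' δi'))) * ‖X‖ ^ 2 ≤ m := by
  intro i
  have h2 : 2 ≤ (F.P Kt).d := by rw [T4Family.P_d]; norm_num
  have hbox' : ∀ κ, (((hi i κ - lo i κ + 1).toNat + 3 : ℕ) : ℤ) ≤ (F.P Kt).sitesPerDir (k i) := fun κ => by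
    have h5 := hN5 i κ
    push_cast
    linarith
  exact chartLetter_of_letters_eta ν Kt h0 h2 (hk0 i) (hk i) (Z i) (Λ i) (T i) (lo i) (hi i) hM2 (hdiv i) hbox' (hΩw i)

/-! ## §2  The endpoint in η-units with the chart side BY NAME: (J0′) R-explicit + (σ) + the η-unit chart constants -/

/-- ★★★ **PROPOSITION 1 [IV] AT PRINT'S (1.74) OBJECT — COERCIVE ROAD — FROM THE R-EXPLICIT (J0′) LETTER, THE GAUGE-LETTER FAMILY (σ) AND THE η-UNIT CHART CONSTANTS.**
This seat's `B15Prop1EndpointFromLetterFamilies.…_ofGaugeChartLettersEta_ofCoercive` (§2 v1.1 there, the η-unit letter form) with the chart family (χ)_η DISCHARGED BY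
NAME from dag-n12-w4's `chartLetter_of_letters_eta` — the η-twin of p631882 §2: the binders `{γ₀} hγ₀ {μc ρc δ₂c Kc τc} hμc0 hρc0
hδ₂c0 hχη` are REPLACED by the chart constants `ρs Cμ Cρ C₂ Cτ : ι → ℝ` (binders, so that `hsm` can be stated before the `∃` opens) with their signs, the body `hchartη` of
`chartLetter_of_letters_eta` per instance (§1 + `choose` supplies it), the tolerances' signs `hδc0 hδin0`, the smallness `hsmall : 0 < max (δc i) (δin i) ≤ ρs i`, `h𝓐₀`; the
numerics `hsm`∕`hγle` are those of p631882 §2 TO THE TOKEN (`μc i := Cμ i·max (δc i) (δin i)`, `ρc i := Cρ i`, `δ₂c i := C₂ i·max …` — (χ)_η's `C₂` already contains the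
row-weight factor `√(Σ_l levelWeight j_l)` —, `Kc i := 12𝓐₀ i∕R i·√(Nat.card {b ∕∕ b.src ∈ Ω₁(Z i)})`, `τc i := 16(d+1)·Cτ i·max …`, `γ₀ := 1`).  Everything else VERBATIM
p631882.  Proof: the Literature η-endpoint at those constants; (χ)_η from `hchartη` with one rewrite `γ₀(k i) = 1` in the Federbush clause.
[cite: Balaban1989LargeFieldI, (1.74) p.192, Prop. 1 (1.77)–(1.78) p.194 (incl. the last clause), (1.79) p.195; Balaban1989LargeFieldII, p.357, (1.7)–(1.9) p.358, (1.12)–(1.13) p.359,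
(17)–(19) pp.360–361; Balaban1985Variational, (3)–(4) p.278, Thm 1 (8) p.279, (16)–(18) p.280, (44)–(48) p.285, Prop. 9 (190) p.309; Balaban1988Convergent, (2.2) p.255, (2.11)–(2.14) pp.256–257] -/
theorem exists_domain_prop1Printed_lfVarOn_std_su2_box_intrinsic_analytic_atZSeqCoPRecord_ofThm1TorusClass_ofMinimiserFamily_ofGaugeLetter_ofChartConstantsEta_ofCoercive
    (ν : Node00.Stage7Numerics) (Kt : ℕ) (hd3 : 3 ≤ (F.P Kt).d) (h0 : 0 < (F.P Kt).d) {ι : Type}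
    (Z Λ : ι → Set (Site (F.P Kt) 0)) (k : ι → ℕ) (M : ι → ℝ) (hk0 : ∀ i, 0 < k i) (hk : ∀ i, k i ≤ (F.P Kt).m + (F.P Kt).K)
    (eR : ι → ℝ) (heR : ∀ i, 0 < eR i)
    (T : ∀ i, Finset (PBond (F.P Kt) (k i)))
    (lo hi : ι → Fin (F.P Kt).d → ℤ) (n : ι → ℕ) (hn : ∀ i κ, hi i κ ≤ lo i κ + n i) (hN : ∀ i, n i + 2 < (F.P Kt).sitesPerDir (k i))
    (hbox : ∀ i, pts (k i) (Λ i) = (castSite '' Set.Icc (lo i) (hi i) : Set (Site (F.P Kt) (k i))))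
    (hZ : ∀ i, (boxPlaqs (lo i - 1) (hi i + 1) : Set (Plaq (F.P Kt) (k i))) ⊆ plaqsInside (pts (k i) (Z i)))
    (hTG0 : ∀ i, T i = (box (fun κ => (hi i κ - lo i κ + 1).toNat) (lo i)).image fun x =>
      (⟨castSite (x - unitVec ⟨0, h0⟩), ⟨0, h0⟩⟩ : PBond (F.P Kt) (k i)))
    (hN5 : ∀ i κ, ((hi i κ - lo i κ + 1).toNat : ℤ) + 5 < (F.P Kt).sitesPerDir (k i))
    (K : ι → ℕ) (hK1 : ∀ i, 1 ≤ K i) (hKn : ∀ i κ, (hi i κ - lo i κ + 1).toNat ≤ K i)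
    (ext : ∀ i, GaugeField (F.P Kt) (k i) SU2 → GaugeField (F.P Kt) (k i) SU2)
    (hext : ∀ i Vk, ext i Vk = extend (pts (k i) (Λ i)) (shellGauge Vk (lo i) (hi i)) Vk)
    (hlohi : ∀ i, lo i ≤ hi i)
    -- the REGION parallelepipeds of the normalisation and the datum tolerances
    (LO HI : ι → Fin (F.P Kt).d → ℤ) (hLO : ∀ i, LO i ≤ lo i - 1) (hHI : ∀ i, hi i + 1 ≤ HI i) (n' : ι → ℕ) (hn' : ∀ i κ, HI i κ ≤ LO i κ + n' i)
    (hn'N : ∀ i, n' i < (F.P Kt).sitesPerDir (k i)) (hR' : ∀ i, (boxPlaqs (LO i) (HI i) : Set (Plaq (F.P Kt) (k i))) ⊆ plaqsInside (pts (k i) (Z i)))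
    (ρn : ι → ℝ)
    (hρn : ∀ i, (((F.P Kt).d : ℝ) * n' i + 1) * ((((F.P Kt).d - 1 : ℕ) : ℝ) * n' i * ((12 * (F.P Kt).d * (n i + 2) ^ 2 + 1) * eR i)
      + 3 * (F.P Kt).d * (n i + 2) ^ 2 * eR i) ≤ ρn i)
    {γ cJ bx : ℝ} (hγ : 0 < γ) (hcJ : 0 ≤ cJ) (hbx : 0 ≤ bx)
    (hbxM : ∀ i, 12 * ((F.P Kt).d : ℝ) * ((n i : ℝ) + 2) ^ 2 ≤ bx * (M i) ^ 2)
    {R 𝓐₀ : ι → ℝ} (hM : ∀ i, 1 ≤ (M i)) (hR : ∀ i, 0 < R i)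
    -- (J0′), R-EXPLICIT: per instance one radius and one bound for every base field of the strict guard
    (hMin : ∀ i Vk, PlaqSmallOn (plaqsInside (pts (k i) (Z i ∩ (Λ i)ᶜ))) (eR i) Vk →
      ∃ Ũ : VecField (F.P Kt) (k i) (EuclideanSpace ℂ (Fin 3)) × VecField (F.P Kt) (k i) (EuclideanSpace ℂ (Fin 3)) →
          PBond (F.P Kt) 0 → Matrix (Fin 2) (Fin 2) ℂ,
        (∀ b a c, DifferentiableOn ℂ (fun z => Ũ z b a c) (ball 0 (R i))) ∧
        (∀ z ∈ ball (0 : VecField (F.P Kt) (k i) (EuclideanSpace ℂ (Fin 3)) × VecField (F.P Kt) (k i) (EuclideanSpace ℂ (Fin 3))) (R i),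
          ∀ b a c, ‖Ũ z b a c‖ ≤ 𝓐₀ i) ∧
        ∀ p B' : VecField (F.P Kt) (k i) E3, ‖p‖ < R i → ‖B'‖ < R i → ∃ U' : GaugeField (F.P Kt) 0 SU2,
          (∀ b, Ũ (cplxVec p, cplxVec B') b = ((U' b : SU2) : Matrix (Fin 2) (Fin 2) ℂ)) ∧
            IsMinimizer (Node00.avOfRecord F 2 Kt) (Node00.regMSCoPOfRecord F 2 ν Kt (k i) (maxDomT ν.M₁ (Z i))) (Bj ν.M₁ (Z i) (k i))
              (avgFamily (Node00.avOfRecord F 2 Kt) (qsstarGIter0 (k i) (expMul su2Chart B' (ext i (expMul su2Chart p Vk))))) U')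
    -- the near-flatness tolerances of the gauge letter and the CHART CONSTANTS of dag-n12-w4's `chartLetter_of_letters` (binders, so that `hsm` can be stated)
    {δc δin : ι → ℝ} (hδc0 : ∀ i, 0 ≤ δc i) (hδin0 : ∀ i, 0 ≤ δin i)
    (ρs Cμ Cρ C₂ Cτ : ι → ℝ) (hCμ : ∀ i, 0 ≤ Cμ i) (hCρ : ∀ i, 0 ≤ Cρ i) (hC₂ : ∀ i, 0 ≤ C₂ i)
    (hsmall : ∀ i, 0 < max (δc i) (δin i) ∧ max (δc i) (δin i) ≤ ρs i) (h𝓐₀ : ∀ i, 0 ≤ 𝓐₀ i)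
    -- (σ) THE GAUGE LETTER per instance, at the guarded base fields with normalised extended datum
    (hσ : ∀ i (Vk : GaugeField (F.P Kt) (k i) SU2), PlaqSmallOn (plaqsInside (pts (k i) (Z i ∩ (Λ i)ᶜ))) (eR i) Vk →
      (∀ b ∈ (boxBonds (LO i) (HI i) : Set (PBond (F.P Kt) (k i))), dist1 (ext i Vk b) ≤ ρn i) →
      ∀ U₀ : GaugeField (F.P Kt) 0 SU2,
        IsMinimizer (Node00.avOfRecord F 2 Kt) (Node00.regMSCoPOfRecord F 2 ν Kt (k i) (maxDomT ν.M₁ (Z i))) (Bj ν.M₁ (Z i) (k i))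
          (avgFamily (Node00.avOfRecord F 2 Kt) (qsstarGIter0 (k i) (ext i Vk))) U₀ →
        ∃ σ : GaugeTransf (F.P Kt) 0 SU2,
          (∀ j, j ≤ k i → ∀ b ∈ bondsOf (Bj ν.M₁ (Z i) (k i) j), toMS σ j b.src = 1 ∧ toMS σ j b.tgt = 1) ∧
            (∀ p : Plaq (F.P Kt) 0, ((⟨p.src, p.μ⟩ : PBond (F.P Kt) 0) ∈ {b : PBond (F.P Kt) 0 | b.src ∈ maxDomT ν.M₁ (Z i) 1} ∨
                (⟨p.src.shift p.μ, p.ν⟩ : PBond (F.P Kt) 0) ∈ {b : PBond (F.P Kt) 0 | b.src ∈ maxDomT ν.M₁ (Z i) 1} ∨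
                (⟨p.src.shift p.ν, p.μ⟩ : PBond (F.P Kt) 0) ∈ {b : PBond (F.P Kt) 0 | b.src ∈ maxDomT ν.M₁ (Z i) 1} ∨
                (⟨p.src, p.ν⟩ : PBond (F.P Kt) 0) ∈ {b : PBond (F.P Kt) 0 | b.src ∈ maxDomT ν.M₁ (Z i) 1}) →
              ‖((gaugeAct σ U₀ ⟨p.src, p.μ⟩ : SU2) : Matrix (Fin 2) (Fin 2) ℂ) - 1‖ ≤ δc i ∧ ‖((gaugeAct σ U₀ ⟨p.src.shift p.μ, p.ν⟩ : SU2) : Matrix (Fin 2) (Fin 2) ℂ) - 1‖ ≤ δc i ∧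
                ‖((gaugeAct σ U₀ ⟨p.src.shift p.ν, p.μ⟩ : SU2) : Matrix (Fin 2) (Fin 2) ℂ) - 1‖ ≤ δc i ∧ ‖((gaugeAct σ U₀ ⟨p.src, p.ν⟩ : SU2) : Matrix (Fin 2) (Fin 2) ℂ) - 1‖ ≤ δc i) ∧
          (∀ b ∈ inputs (Bj ν.M₁ (Z i) (k i)), ‖((gaugeAct σ U₀ b : SU2) : Matrix (Fin 2) (Fin 2) ℂ) - 1‖ ≤ δin i))
    -- (χ)_η AT THE η-UNIT CHART CONSTANTS: the body of dag-n12-w4's `chartLetter_of_letters_eta` after its `∃ ρs Cμ Cρ C₂ Cτ`, per instance (supplied by `hchart_of_chartLetter_eta` + `choose`;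
    -- dag-n12-w4's geometry letter `hΩw` is consumed THERE, not here)
    (hchartη : ∀ i,
      ∀ (ext' : GaugeField (F.P Kt) (k i) SU2 → GaugeField (F.P Kt) (k i) SU2) (Vk : GaugeField (F.P Kt) (k i) SU2) {R' A' : ℝ}, 0 < R' → 0 ≤ A' →
      ∀ {δ' δi' : ℝ}, 0 ≤ δ' → 0 ≤ δi' → 0 < max δ' δi' → max δ' δi' ≤ ρs i →
      ∀ (U₀ : GaugeField (F.P Kt) 0 SU2) (Xf : GaugeSlice (pts (k i) (Λ i)) (T i) E3 → PBond (F.P Kt) 0 → lieSU (Fin 2)),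
      IsMinimizer (Node00.avOfRecord F 2 Kt) (Node00.regMSCoPOfRecord F 2 ν Kt (k i) (maxDomT ν.M₁ (Z i))) (Bj ν.M₁ (Z i) (k i))
        (avgFamily (Node00.avOfRecord F 2 Kt) (qsstarGIter0 (k i) (ext' Vk))) U₀ →
      (∀ p : Plaq (F.P Kt) 0, ((⟨p.src, p.μ⟩ : PBond (F.P Kt) 0) ∈ {b : PBond (F.P Kt) 0 | b.src ∈ maxDomT ν.M₁ (Z i) 1} ∨
          (⟨p.src.shift p.μ, p.ν⟩ : PBond (F.P Kt) 0) ∈ {b : PBond (F.P Kt) 0 | b.src ∈ maxDomT ν.M₁ (Z i) 1} ∨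
          (⟨p.src.shift p.ν, p.μ⟩ : PBond (F.P Kt) 0) ∈ {b : PBond (F.P Kt) 0 | b.src ∈ maxDomT ν.M₁ (Z i) 1} ∨
          (⟨p.src, p.ν⟩ : PBond (F.P Kt) 0) ∈ {b : PBond (F.P Kt) 0 | b.src ∈ maxDomT ν.M₁ (Z i) 1}) →
        ‖((U₀ ⟨p.src, p.μ⟩ : SU2) : Matrix (Fin 2) (Fin 2) ℂ) - 1‖ ≤ δ' ∧ ‖((U₀ ⟨p.src.shift p.μ, p.ν⟩ : SU2) : Matrix (Fin 2) (Fin 2) ℂ) - 1‖ ≤ δ' ∧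
          ‖((U₀ ⟨p.src.shift p.ν, p.μ⟩ : SU2) : Matrix (Fin 2) (Fin 2) ℂ) - 1‖ ≤ δ' ∧ ‖((U₀ ⟨p.src, p.ν⟩ : SU2) : Matrix (Fin 2) (Fin 2) ℂ) - 1‖ ≤ δ') →
      (∀ b ∈ inputs (Bj ν.M₁ (Z i) (k i)), ‖((U₀ b : SU2) : Matrix (Fin 2) (Fin 2) ℂ) - 1‖ ≤ δi') →
      Xf 0 = 0 → ContDiffAt ℝ 2 Xf 0 →
      (∀ᶠ Y in 𝓝 (0 : GaugeSlice (pts (k i) (Λ i)) (T i) E3),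
        IsMinimizer (Node00.avOfRecord F 2 Kt) (Node00.regMSCoPOfRecord F 2 ν Kt (k i) (maxDomT ν.M₁ (Z i))) (Bj ν.M₁ (Z i) (k i))
          (avgFamily (Node00.avOfRecord F 2 Kt) (qsstarGIter0 (k i) (expMul su2Chart (ιA (pts (k i) (Λ i)) (T i) Y) (ext' Vk)))) (expChart U₀ (Xf Y))) →
      (∀ (X : GaugeSlice (pts (k i) (Λ i)) (T i) E3) (b : PBond (F.P Kt) 0),
        ‖((fderiv ℝ Xf 0 X b : lieSU (Fin 2)) : Matrix (Fin 2) (Fin 2) ℂ)‖ ≤ 8 * A' / R' * ‖X‖ ∧ ‖fderiv ℝ Xf 0 X b‖ ≤ 12 * A' / R' * ‖X‖) →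
      (∀ (X : GaugeSlice (pts (k i) (Λ i)) (T i) E3) (b : PBond (F.P Kt) 0), b.src ∉ maxDomT ν.M₁ (Z i) 1 → fderiv ℝ Xf 0 X b = 0) →
      ∃ (Ψ₂ : (PBond (F.P Kt) 0 → lieSU (Fin 2)) →L[ℝ] (PBond (F.P Kt) 0 → lieSU (Fin 2)) →L[ℝ] (Fin (constrCard (Bj ν.M₁ (Z i) (k i)) (k i)) → lieSU (Fin 2)))
        (lam : (Fin (constrCard (Bj ν.M₁ (Z i) (k i)) (k i)) → lieSU (Fin 2)) →L[ℝ] ℝ)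
        (p : Seminorm ℝ (PBond (F.P Kt) 0 → lieSU (Fin 2)))
        (Lf : (PBond (F.P Kt) 0 → lieSU (Fin 2)) →L[ℝ] (Fin (constrCard (Bj ν.M₁ (Z i) (k i)) (k i)) → lieSU (Fin 2)))
        (Rf : (Fin (constrCard (Bj ν.M₁ (Z i) (k i)) (k i)) → lieSU (Fin 2)) → PBond (F.P Kt) 0 → lieSU (Fin 2)),
        HasFDerivAt (fun Y => fderiv ℝ (msChart F 2 Kt (k i) (Bj ν.M₁ (Z i) (k i)) (avgFamily (Node00.avOfRecord F 2 Kt) (qsstarGIter0 (k i) (ext' Vk))) U₀) Y) Ψ₂ 0 ∧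
        (∀ᶠ Y in 𝓝 (0 : PBond (F.P Kt) 0 → lieSU (Fin 2)),
          DifferentiableAt ℝ (msChart F 2 Kt (k i) (Bj ν.M₁ (Z i) (k i)) (avgFamily (Node00.avOfRecord F 2 Kt) (qsstarGIter0 (k i) (ext' Vk))) U₀) Y) ∧
        fderiv ℝ (fun Y : PBond (F.P Kt) 0 → lieSU (Fin 2) => wilsonAction4 (expChart U₀ Y)) 0 =
          lam.comp (fderiv ℝ (msChart F 2 Kt (k i) (Bj ν.M₁ (Z i) (k i)) (avgFamily (Node00.avOfRecord F 2 Kt) (qsstarGIter0 (k i) (ext' Vk))) U₀) 0) ∧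
        (∀ Y : PBond (F.P Kt) 0 → lieSU (Fin 2), ∑ b, ‖(Y b : Matrix (Fin 2) (Fin 2) ℂ)‖ ^ 2 ≤ p Y ^ 2) ∧
        (∀ v, Lf (Rf v) = v) ∧ (∀ v, p (Rf v) ≤ Cρ i * Real.sqrt (∑ l, ((((F.P Kt).L : ℝ) ^ (F.P Kt).d) / (((F.P Kt).L : ℝ) ^ 2)) ^ (((Node00.constrEnum (Bj ν.M₁ (Z i) (k i) : DetSet (F.P Kt)) (k i)).symm l).1 : ℕ) * ‖(v) l‖ ^ 2)) ∧
        ∀ X : GaugeSlice (pts (k i) (Λ i)) (T i) E3,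
          Real.sqrt (∑ l, ((((F.P Kt).L : ℝ) ^ (F.P Kt).d) / (((F.P Kt).L : ℝ) ^ 2)) ^ (((Node00.constrEnum (Bj ν.M₁ (Z i) (k i) : DetSet (F.P Kt)) (k i)).symm l).1 : ℕ) * ‖(fderiv ℝ (msChart F 2 Kt (k i) (Bj ν.M₁ (Z i) (k i)) (avgFamily (Node00.avOfRecord F 2 Kt) (qsstarGIter0 (k i) (ext' Vk))) U₀) 0 (fderiv ℝ Xf 0 X) - Lf (fderiv ℝ Xf 0 X)) l‖ ^ 2)
            ≤ (C₂ i * max δ' δi') * p (fderiv ℝ Xf 0 X) ∧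
          lam (Ψ₂ (fderiv ℝ Xf 0 X) (fderiv ℝ Xf 0 X)) ≤ (Cμ i * max δ' δi') * p (fderiv ℝ Xf 0 X) ^ 2 ∧
          p (fderiv ℝ Xf 0 X) ≤ (12 * A' / R' * Real.sqrt (Nat.card {b : PBond (F.P Kt) 0 // b.src ∈ maxDomT ν.M₁ (Z i) 1})) * ‖X‖ ∧
          ∃ m : ℝ, (∀ w', Lf w' = fderiv ℝ (msChart F 2 Kt (k i) (Bj ν.M₁ (Z i) (k i)) (avgFamily (Node00.avOfRecord F 2 Kt) (qsstarGIter0 (k i) (ext' Vk))) U₀) 0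
                (fderiv ℝ Xf 0 X) →
              m ≤ fderiv ℝ (fun Y => fderiv ℝ (fun Y : PBond (F.P Kt) 0 → lieSU (Fin 2) => wilsonAction4 (expChart (1 : GaugeField (F.P Kt) 0 SU2) Y)) Y) 0 w' w') ∧
            (((F.P Kt).L : ℝ) ^ (F.P Kt).d) ^ (k i) / ((((F.P Kt).L : ℝ)) ^ 2 * ((F.P Kt).L : ℝ) ^ 2) ^ (k i) *
                (∑ z ∈ box (fun κ => (hi i κ - lo i κ + 1).toNat + 3) (fun κ => lo i κ - 2), ∑ μ : Fin (F.P Kt).d, ∑ a : Fin 3,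
                  curl (fun b => ιA (pts (k i) (Λ i)) (T i) X (⟨castSite b.1, b.2⟩ : PBond (F.P Kt) (k i)) a) z ⟨0, h0⟩ μ ^ 2)
              - ((((F.P Kt).L : ℝ) ^ (F.P Kt).d) ^ (k i) / ((((F.P Kt).L : ℝ)) ^ 2 * ((F.P Kt).L : ℝ) ^ 2) ^ (k i)
                  * (16 * (((F.P Kt).d : ℝ) + 1) * (Cτ i * max δ' δi'))) * ‖X‖ ^ 2 ≤ m)
    -- numerics IN THE CHART CONSTANTS (`γ₀ := 1`: dag-n12-w4's per-instance `γ₀(k) = (L^d)^k∕(L²·L²)^k` is `1` at `d = 4`): the assembled `Cerr i` is small, the positivity constant fits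
    (hsm : ∀ i, (32 * (((F.P Kt).d : ℝ) - 1) * δc i + Cμ i * max (δc i) (δin i)
        + 16 * (((F.P Kt).d : ℝ) - 1) * (Cρ i * (C₂ i * max (δc i) (δin i))) * (2 + Cρ i * (C₂ i * max (δc i) (δin i))))
        * (12 * 𝓐₀ i / R i * Real.sqrt (Nat.card {b : PBond (F.P Kt) 0 // b.src ∈ maxDomT ν.M₁ (Z i) 1})) ^ 2
        + 16 * (((F.P Kt).d : ℝ) + 1) * (Cτ i * max (δc i) (δin i))
      ≤ 1 / (2 * (3 * (K i : ℝ) ^ 2 + 2 * (K i : ℝ) ^ 4)))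
    (hγle : ∀ i, γ / (M i) ^ 5 ≤ 1 / (2 * (3 * (K i : ℝ) ^ 2 + 2 * (K i : ℝ) ^ 4)))
    (hfar : ∀ i (b : PBond (F.P Kt) 0), b.src ∉ maxDomT ν.M₁ (Z i) 1 →
      (⟨blockIter (k i) b.src, b.dir⟩ : PBond (F.P Kt) (k i)) ∉ bondsOf (pts (k i) (Λ i)))
    (hZblk : ∀ i, IsBlockUnion (k i) (Z i))
    (hM2 : 2 ≤ ν.M₁) (hdiv : ∀ i, side (F.P Kt).L ν.M₁ (k i) ∣ (F.P Kt).sitesPerDir 0)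
    {cE B₃ a₀ a₁' cA : ℝ} (hcE0 : 0 ≤ cE) (hcE : ∀ i, 12 * ((F.P Kt).d : ℝ) * ((n i : ℝ) + 2) ^ 2 ≤ cE) (hB₃ : 0 ≤ B₃)
    (heRa : ∀ i, (cE + 1) * eR i ≤ a₁' ∧ B₃ * ((cE + 1) * eR i) ≤ ν.εreg) (ha₀ : ν.εreg ≤ a₀)
    (hcA : 1 / 2 * (B₃ * (cE + 1) * (F.P Kt).eta 1 ^ 2) ^ 2 * (Fintype.card (Plaq (F.P Kt) 0) : ℝ) ≤ cA)
    (h15T : ∀ (k' : ℕ), k' ≤ (F.P Kt).m + (F.P Kt).K → side (F.P Kt).L ν.M₁ k' ∣ (F.P Kt).sitesPerDir 0 →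
      ∀ (s : B14.Eq218Concrete.Seq (fun n : ℕ => Node00.unionsOfCubes (F.P Kt) (side (F.P Kt).L ν.M₁ n)) k'),
      Node00.Sect2.SeqSeparated ν.M₁ s → 0 < ν.M₁ →
      ∀ (ε₀ : ℝ) (δ : ℕ → ℝ), (∀ j, j ≤ k' → 0 < δ j ∧ δ j ≤ a₁' ∧ B₃ * δ j ≤ ε₀) → (∀ j, j < k' → δ j ≤ 2 * δ (j + 1)) →
      (∀ j, j < k' → δ (j + 1) ≤ 2 * δ j) → ε₀ ≤ a₀ →
      ∀ W : MSField (F.P Kt) SU2,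
        Node00.Sect2.DataSmall7PTop (Node00.avOfRecord F 2 Kt) s.Ω (Node00.suppDomOfRecord F ν Kt s.Ω) k' δ W →
        ∀ U₀ : GaugeField (F.P Kt) 0 SU2, IsMinimizer (Node00.avOfRecord F 2 Kt)
            {U | (∀ j, j ≤ k' → PlaqSmallOn (Node00.Sect2.omegaPlaqsTop s.Ω (Node00.suppDomOfRecord F ν Kt s.Ω) j)
                (ε₀ * (F.P Kt).eta j ^ 2) U) ∧
              Node00.Sect2.CoDivClassOnTop s.Ω (Node00.suppDomOfRecord F ν Kt s.Ω) k' ε₀ U}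
            (genSet s.Ω k') W U₀ →
          (∀ j, j ≤ k' → PlaqSmallOn (Node00.Sect2.omegaPlaqsTop s.Ω (Node00.suppDomOfRecord F ν Kt s.Ω) j)
              (B₃ * δ j * (F.P Kt).eta j ^ 2) U₀) ∧
            ∀ j, j ≤ k' → Node00.Sect2.CoDivSmallOn (Node00.Sect2.omegaBondsTop s.Ω (Node00.suppDomOfRecord F ν Kt s.Ω) j)
              (B₃ * δ j * (F.P Kt).eta j ^ 3) U₀)
    (hcJ' : ∀ i, 2 * cA * eR i / R i + 4 * ((Fintype.card (Plaq (F.P Kt) 0) : ℝ) * (1 + 8 * 𝓐₀ i ^ 4)) / (R i * eR i) ≤ cJ)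
    : ∃ a₁ : ι → ℝ, (∀ i, 0 < a₁ i) ∧
      B15.Prop1Printed (lfVarOn su2Chart fun i =>
        InstOn.std (Node00.bgMSCoPOfRecord F 2 ν Kt (k i) (maxDomT ν.M₁ (Z i))) ν.M₁ (Z i) (Λ i) (k i) (M i) (a₁ i)
          (anExt (pts (k i) (Λ i)) (T i)
            (fun177std (Node00.bgMSCoPOfRecord F 2 ν Kt (k i) (maxDomT ν.M₁ (Z i))) ν.M₁ (Z i) (k i)) (ext i)
            (min (1 / 2) (min (R i / 8) (γ / (M i) ^ 5 * (R i / 2) ^ 2 /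
              (48 * (4 * ((Fintype.card (Plaq (F.P Kt) 0) : ℝ) * (1 + 8 * 𝓐₀ i ^ 4)) / R i + 1)))))))
    := by
  refine B15Prop1EndpointFromLetterFamilies.exists_domain_prop1Printed_lfVarOn_std_su2_box_intrinsic_analytic_atZSeqCoPRecord_ofThm1TorusClass_ofMinimiserFamily_ofGaugeChartLettersEta_ofCoercive
    ν Kt hd3 h0 Z Λ k M hk0 hk eR heR T lo hi n hn hN hbox hZ hTG0 hN5 K hK1 hKn ext hext hlohi LO HI hLO hHI n' hn' hn'N hR' ρn hρn hγ hcJ hbx hbxM hM hR hMin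
    (γ₀ := 1) zero_le_one (δc := δc) (δin := δin)
    (μc := fun i => Cμ i * max (δc i) (δin i)) (ρc := Cρ) (δ₂c := fun i => C₂ i * max (δc i) (δin i))
    (Kc := fun i => 12 * 𝓐₀ i / R i * Real.sqrt (Nat.card {b : PBond (F.P Kt) 0 // b.src ∈ maxDomT ν.M₁ (Z i) 1}))
    (τc := fun i => 16 * (((F.P Kt).d : ℝ) + 1) * (Cτ i * max (δc i) (δin i)))
    hδc0 (fun i => mul_nonneg (hCμ i) ((hδc0 i).trans (le_max_left _ _))) hCρ
    (fun i => mul_nonneg (hC₂ i) ((hδc0 i).trans (le_max_left _ _))) hσ ?_ hsm hγle hfar hZblk hM2 hdiv hcE0 hcE hB₃ heRa ha₀ hcA h15T hcJ'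
  -- (χ)_η from the η-unit chart constants: dag-n12-w4's body at `ext i`, `R i`, `𝓐₀ i`, `δc i`, `δin i`, with `γ₀(k i) = 1`
  intro i Vk _hV _hnV U₀ Xf hmin hC1 hCin hX₀ hXc hfam hK hsupp
  obtain ⟨Ψ₂, lam, p, Lf, Rf, hΨ₂, hΨd, hlam, hp, hRf, hρ, hX⟩ :=
    hchartη i (ext i) Vk (hR i) (h𝓐₀ i) (hδc0 i) (hδin0 i) (hsmall i).1 (hsmall i).2 U₀ Xf hmin hC1 hCin hX₀ hXc hfam hK hsupp
  refine ⟨Ψ₂, lam, p, Lf, Rf, hΨ₂, hΨd, hlam, hp, hRf, hρ, fun X => ?_⟩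
  obtain ⟨hδ₂, hμ, hKc, m, hm, hcirc⟩ := hX X
  refine ⟨hδ₂, hμ, hKc, m, hm, ?_⟩
  -- `γ₀(k i) = 1` on the four-torus
  have hL : (0 : ℝ) < ((F.P Kt).L : ℝ) := Nat.cast_pos.mpr (F.P Kt).L_pos
  have hA : (((F.P Kt).L : ℝ) ^ (F.P Kt).d) ^ (k i) / ((((F.P Kt).L : ℝ)) ^ 2 * ((F.P Kt).L : ℝ) ^ 2) ^ (k i) = 1 := by
    rw [T4Family.P_d, show (((F.P Kt).L : ℝ)) ^ 2 * ((F.P Kt).L : ℝ) ^ 2 = ((F.P Kt).L : ℝ) ^ 4 by ring]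
    exact div_self (pow_ne_zero _ (pow_ne_zero _ hL.ne'))
  rw [hA, one_mul, one_mul] at hcirc
  simpa only [one_mul] using hcirc

end Summit.QuantumFields.YangMills.BalabanUVNodes.N12Prop1OfGaugeLetterAndChartConstantsEta

end
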